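import Summits.QuantumFields.YangMills.Theses.LangevinControlUV
import Summits.QuantumFields.YangMills.Theorems.LatticeGapInUVUnits.Negative.SlowRulers
import Literature.MathematicalPhysics.QuantumLattice.GaugeGroupsProofs

/-!
# `LatticeGapInUVUnits` is false in the standard scaling picture — negative lemma modulo `StandardScalingSU`

Negative-side file for crux `stmt-QuantumFields-9366` =
`Summit.QuantumFields.YangMills.Theses.LangevinControlUV.LatticeGapInUVUnits` (route `LangevinControlUV`, rank 5):
"for every compact simple `G`, faithful `r` and EVERY unit map `a : ℝ → ℝ` carrying the femto two-point package
(two-sided bounds `c Γ(n a(β)) ≤ n⁸ Cov ≤ C Γ(n a(β))` on all tori with `L a(β) ≤ ℓ₀`, one shape function `Γ`),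
all pairs of gauge-invariant local observables cluster on all large tori at rate `c₁ · a(β)` per lattice step".

## Result

`latticeGapInUVUnits_false_of_standardScalingSU : StandardScalingSU → ¬ LatticeGapInUVUnits`, kernel-checked and
sorry-free, where the hypothesis `H = StandardScalingSU` is the conjunction, for ONE `SU(N)`, `N ≥ 2` (a compact
simple Lie group UNCONDITIONALLY: tree theorem `isSimpleCompactGroup_specialUnitaryGroup_holds`), of

* `FixedTorusTwoSided` (ultraviolet, finite-dimensional): on every FIXED torus the plaquette covariances are
  two-sided `≍ β⁻² · dist⁻⁸` for `β ≥ B(L)`, constants uniform in `L`, threshold `B(L)` arbitrary;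
* `XiUnbounded` (infrared, WEAK form): for every `ε > 0`, at arbitrarily large couplings the exponential clustering
  rate of some fixed pair of local observables on large tori is `< ε` — the correlation length in lattice units
  is unbounded along some sequence `β_j → ∞` (implied by `ξ(β) → ∞`, Chatterjee, arXiv:1803.01950, Problem 5.1).

Neither half mentions unit maps, shape functions, multiscale bounds or the route; both are universally believed and
both are open as theorems (hence a NEGATIVE LEMMA MODULO `H`, not a refutation: the item stays open, held).

## Mechanism (why the typed `∀ a` is too strong)

`exists_slow_package` (an instance of the pure-Mathlib `exists_slow_ruler_antitone` of `Negative/SlowRulers.lean`):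
`FixedTorusTwoSided r` alone manufactures, above ANY prescribed antitone function `ω → 0`, an admissible
unit map — a dyadic STEP ruler `a(β) = u_k` on `[2^k, 2^{k+1})` with GENERIC values `u_k² = t_k √p_k` (`t_k ∈ ℚ`,
`p_k` the `k`-th prime; `step_eq_of_sqrt_mul_eq`: the grids `{√m · u_k}` of different steps never meet, by the
irrationality of `√(p_k p_j)`), `u_k ∈ (lo_k, 2 lo_k)` where `lo_k = max(1/(M_k + 2), ω(2^k))` and `M_k + 1` is the
largest torus side whose (cumulative) threshold is `≤ 2^k`. The shape function is `Γ := 4^{-k}` on the `k`-th grid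
and `1` elsewhere; the femto condition `L · u_k ≤ 1` forces `L ≤ M_k + 1`, so every femto box of step `k` obeys the
fixed-torus bounds at every `β ∈ [2^k, 2^{k+1})`, where `β⁻² ∈ (4^{-k-1}, 4^{-k}]`: the package holds with
`c = c₀/4`, `C = C₀`, `ℓ₀ = 1`, and `a ≥ ω` on `[1, ∞)` for antitone `ω`. From `XiUnbounded` choose couplings
`βs j ≥ j + 1`, increasing, at which the pair `(A, B)` clusters more slowly than rate `ε_j = 1/(j+1)²`, and the
antitone floor `ω(β) = 1/(J(β) + 1)`, `J(β)` the first index with `β ≤ βs j` (so `ω(βs j) ≥ 1/(j+1)`, `ω → 0`). The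
crux applied to the ruler above `ω` yields a rate `c₁ > 0`; at `βs j` with `1/(j+1) < c₁` it demands clustering at
rate `c₁ a(βs j) ≥ c₁/(j+1) > ε_j` on all large tori, against the choice of `βs j`: contradiction. No perturbation
theory, no cluster expansion: order bookkeeping, `Nat.findGreatest`, `Nat.log 2 ⌊β⌋₊`, `sInf` on `ℕ`.

## Classification and repair (for the planner)

If `H` is ever discharged the refutation is `refuted-misstated`: the witness is a slowly, generically decaying STEP
unit map that no one intends. Minimal repairs C′ that the witness misses: restrict the crux (and the sibling items
9365/9367 with the same hypothesis) to `Continuous a` (then every level `n a(β) = s` is met at unboundedly many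
couplings and the two-sided clause pins `a ≍ a_phys`), or add `MonotoneOn Γ (Set.Ioc 0 ℓ₀)` inside the package
(the levels `4^{-k} ↓` along `s ↓` of the witness violate it; `FemtoCurvatureTwoPoint` must then produce a monotone
`Γ`, which the physical `Γ(s) ≍ ḡ⁴(s)` is). Inside the route `closes` feeds the crux only the unit map produced by
`FemtoCurvatureTwoPoint`, so either repair costs the assembly nothing.

Companions: the standing disprover's work file `Cruxes/LatticeGapInUVUnits/Disproof.lean` (§0–§9: anatomy, scale
covariance, junk group, `a → 0` load-bearing, weak-coupling concentration, uniform-`C` strengthening false), the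
sibling negative files `Negative/WeakCouplingConcentration.lean`, `Negative/UniformConstantFalse.lean`, the cards
`Cruxes/FemtoCurvatureTwoPoint/Ideas/generic-step-gamma-encoding.md` (whose C⁺ is `FixedTorusTwoSided`) and
`Cruxes/LatticeGapInUVUnits/TypedDefect9366.md` (which asked for exactly this lemma).
-/

namespace Summit.QuantumFields.YangMills.Theorems.LatticeGapInUVUnits.Negative

open Filter Topology MeasureTheory
open Literature.MathematicalPhysics.QuantumFieldTheory Literature.MathematicalPhysics.QuantumLattice
open Summit.QuantumFields.YangMills.Theses.LangevinControlUV (LatticeGapInUVUnits)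

noncomputable section

section Parts

variable {G : Type} [Group G] [TopologicalSpace G] [IsTopologicalGroup G] [CompactSpace G]
  [MeasurableSpace G] [BorelSpace G]

/-- The plaquette field `P_x^{ij}(U) = N − Re tr r(U_{x,ij})` of the crux (its `let P`). [folklore] -/
def plaqField (r : LatticeRep G) {L : ℕ} (x : Site 4 L) (i j : Fin 4) (U : GaugeConfig 4 L G) : ℝ :=
  (r.N : ℝ) - (r.ρ (plaquetteHolonomy U x i j)).trace.re

/-- Covariance under Wilson's measure on the torus of side `L` at coupling `β` (the crux's `let cov`). [folklore] -/
def wcov (r : LatticeRep G) {L : ℕ} [NeZero L] (β : ℝ) (F F' : GaugeConfig 4 L G → ℝ) : ℝ :=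
  wilsonExpectation (d := 4) (L := L) r.ρ β (fun U => F U * F' U) -
    wilsonExpectation (d := 4) (L := L) r.ρ β F * wilsonExpectation (d := 4) (L := L) r.ρ β F'

/-- Torus Euclidean distance (the crux's `let dist`). [folklore] -/
def torusDist {L : ℕ} (x y : Site 4 L) : ℝ :=
  Real.sqrt (∑ k : Fin 4, (((x k - y k).valMinAbs : ℤ) : ℝ) ^ 2)

/-- The axis covariance `Cov(P_0^{01}, P_{n e₂}^{01})` on the torus of side `L`. [folklore] -/
def axisCov (r : LatticeRep G) (L : ℕ) [NeZero L] (β : ℝ) (n : ℕ) : ℝ :=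
  wcov r β (plaqField r (0 : Site 4 L) 0 1) (plaqField r (Pi.single (2 : Fin 4) ((n : ℕ) : ZMod L)) 0 1)

omit [TopologicalSpace G] [IsTopologicalGroup G] [CompactSpace G] [MeasurableSpace G] [BorelSpace G] in
/-- Torus distances between distinct sites are square roots of positive integers. [folklore] -/
theorem torusDist_eq_sqrt {L : ℕ} [NeZero L] {x y : Site 4 L} (hxy : x ≠ y) :
    ∃ m : ℕ, 1 ≤ m ∧ torusDist x y = Real.sqrt m := by
  refine ⟨∑ k : Fin 4, (x k - y k).valMinAbs.natAbs ^ 2, ?_, ?_⟩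
  · obtain ⟨k, hk⟩ : ∃ k, x k ≠ y k := by
      by_contra h
      push Not at h
      exact hxy (funext h)
    have hne : (x k - y k).valMinAbs ≠ 0 := by
      rw [Ne, ZMod.valMinAbs_eq_zero]
      exact sub_ne_zero.2 hk
    have h1 : 1 ≤ (x k - y k).valMinAbs.natAbs ^ 2 :=
      Nat.one_le_pow _ _ (Int.natAbs_pos.2 hne)
    exact h1.trans (Finset.single_le_sum (f := fun k => (x k - y k).valMinAbs.natAbs ^ 2)
      (fun _ _ => Nat.zero_le _) (Finset.mem_univ k))
  · unfold torusDist
    congr 1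
    push_cast
    refine Finset.sum_congr rfl fun k _ => ?_
    rw [Nat.cast_natAbs, Int.cast_abs, sq_abs]

/-- **H_UV — fixed-torus two-sided plaquette asymptotics at weak coupling.** There are constants `0 < c₀ (≤ C₀)`
such that on EVERY periodic torus `(ℤ/L)⁴`, beyond an `L`-dependent and otherwise arbitrary threshold `B(L)`, the
connected plaquette–plaquette covariances under Wilson's measure `wilsonMeasure r.ρ β` satisfy
`c₀ ≤ β² · n⁸ · Cov(P_0^{01}, P_{n e₂}^{01}) ≤ C₀` for `1 ≤ n ≤ L/8` and
`β² · |Cov(P_x^{ij}, P_y^{i'j'})| · dist(x, y)⁸ ≤ C₀` for `x ≠ y` (`P = N − Re tr r(U_p)`, torus distance).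
Content: the leading `β → ∞` (Laplace) asymptotics of these covariances on a FIXED finite lattice is the Gaussian
one-gluon-exchange-squared term `2 Σ |K_{L,θ}(x)|² β⁻²` around the flat connections, two-sided along the axis under
the margin `8 n ≤ L` and `O(dist⁻⁸)` for all pairs, uniformly in `L` and in the flat (toron) background `θ`, the
constant modes contributing `O(β⁻² L⁻⁸)` (femto-universe perturbation theory: Lüscher 1983; zero-momentum modes on
the periodic torus: Coste–González-Arroyo–Jurkiewicz–Korthals Altes 1985). No relation between `β` and `L` is
asserted, no renormalisation group, no unit map: one finite-dimensional statement per `L` with `L`-uniform LIMITING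
constants. Believed for every compact simple `G` (for `SU(2)` the logarithmically divergent zero-mode integral makes
the `L`-uniformity the delicate point; `N ≥ 3` is safe), unproved: rigorous `β → ∞` lattice asymptotics exist only
for the free energy. It is the hypothesis C⁺ = `FixedTorusSemiclassicalTwoPoint` of crux-idea card
`Cruxes/FemtoCurvatureTwoPoint/Ideas/generic-step-gamma-encoding` (triage r1: pass). [cite: Luscher1983] [cite: CosteEtAl1985] -/
@[conjecture] def FixedTorusTwoSided (r : LatticeRep G) : Prop :=
  ∃ c₀ C₀ : ℝ, 0 < c₀ ∧ ∀ (L : ℕ) [NeZero L], ∃ B : ℝ, ∀ β : ℝ, B ≤ β →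
    (∀ n : ℕ, 1 ≤ n → 8 * n ≤ L →
        c₀ ≤ β ^ 2 * ((n : ℝ) ^ 8 * axisCov r L β n) ∧ β ^ 2 * ((n : ℝ) ^ 8 * axisCov r L β n) ≤ C₀) ∧
      ∀ (x y : Site 4 L) (i j i' j' : Fin 4), x ≠ y → i ≠ j → i' ≠ j' →
        β ^ 2 * (|wcov r β (plaqField r x i j) (plaqField r y i' j')| * torusDist x y ^ 8) ≤ C₀

/-- **H_IR — the correlation length in lattice units is unbounded at weak coupling (`limsup_β ξ(β) = ∞`,
torus form).** There are two gauge-invariant local lattice observables `A, B` such that for every rate `ε > 0`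
there are ARBITRARILY LARGE couplings `β` at which the connected torus correlation `⟨A · τ_n B⟩ − ⟨A⟩⟨B⟩`
(`latticeConnectedCorr`) is NOT `O(e^{−ε n})` uniformly on large tori: for every `S₀` and every constant `C` there
are a torus of side `2S + 1 ≥ 2S₀ + 1` and a separation `n ≤ S` with `C · e^{−ε n} < |corr_{β, 2S+1}(A, B, n)|`.
In words: along SOME sequence `β_j → ∞` the clustering rate of the pair `(A, B)` tends to `0` — weaker than
`ξ(β) → ∞` (Chatterjee, arXiv:1803.01950, Problem 5.1, which asserts it along ALL `β → ∞`; asymptotic scaling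
predicts `ξ(β) ≍ β^{…} e^{β/(8 b₀)}` for `SU(N)`: take any glueball channel with non-zero overlap, e.g. `A = B =`
the plaquette). OPEN for every 4D non-abelian theory (cf. the `ξ → ∞` clause of the tree's registered open problem
`Literature.MathematicalPhysics.QuantumFieldTheory.LatticeMassGapAllCouplings`); known only for abelian `U(1)₄`
(Guth; Fröhlich–Spencer), which is not simple. [cite: arXiv180301950, Problem 5.1] -/
@[conjecture] def XiUnbounded (r : LatticeRep G) : Prop :=
  ∃ A B : YMSpecies G, ∀ ε : ℝ, 0 < ε → ∀ b : ℝ, ∃ β : ℝ, b ≤ β ∧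
    ∀ (S₀ : ℕ) (C : ℝ), ∃ S : ℕ, S₀ ≤ S ∧ ∃ n : ℕ, n ≤ S ∧
      C * Real.exp (-(ε * n)) < |latticeConnectedCorr r.ρ β (2 * S + 1) A.F B.F n|

/-- **Slow admissible rulers from fixed-torus asymptotics (the generic-step encoding, instantiated).** If the
plaquette covariances of every fixed torus are two-sided `≍ β⁻²` beyond a threshold (`FixedTorusTwoSided r`), then
above ANY antitone function `ω → 0` there is a unit map `a > 0`, `a → 0`, `a ≥ ω` on `[1, ∞)`, carrying the femto
two-point package of the crux with `ℓ₀ = 1` (shape function `Γ ∈ (0, 1]`, constants `c = c₀/4 > 0`, `C = C₀`) —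
`exists_slow_ruler_antitone` (`Negative/SlowRulers.lean`) applied to `X = n⁸ · axisCov`, `Y = |Cov| · dist⁸` over
pairs of distinct sites and of planes, `D = dist`. So the femto package, as typed, pins NO rate of decay of `a`
from below: it is satisfiable by rulers decaying as slowly as one likes, with no ultraviolet input beyond
fixed-lattice asymptotics. [folklore] -/
theorem exists_slow_package (r : LatticeRep G) (hT : FixedTorusTwoSided r) (ω : ℝ → ℝ)
    (hω : Tendsto ω atTop (𝓝 0)) (hanti : Antitone ω) :
    ∃ (a Γ : ℝ → ℝ) (β₀ c C : ℝ), 0 < c ∧ (∀ β, 0 < a β) ∧ Tendsto a atTop (𝓝 0) ∧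
      (∀ s : ℝ, 0 < s → s ≤ 1 → 0 < Γ s ∧ Γ s ≤ 1) ∧
      (∀ (L : ℕ) [NeZero L] (β : ℝ), β₀ ≤ β → (L : ℝ) * a β ≤ 1 →
        (∀ n : ℕ, 1 ≤ n → 8 * n ≤ L →
            c * Γ ((n : ℝ) * a β) ≤ (n : ℝ) ^ 8 * axisCov r L β n ∧
              (n : ℝ) ^ 8 * axisCov r L β n ≤ C * Γ ((n : ℝ) * a β)) ∧
          ∀ (x y : Site 4 L) (i j i' j' : Fin 4), x ≠ y → i ≠ j → i' ≠ j' →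
            |wcov r β (plaqField r x i j) (plaqField r y i' j')| * torusDist x y ^ 8 ≤
              C * Γ (torusDist x y * a β)) ∧
      ∀ β : ℝ, 1 ≤ β → ω β ≤ a β := by
  obtain ⟨c₀, C₀, hc₀, hT⟩ := hT
  -- pairs of distinct sites and of planes on the torus of side `m + 1`
  let ι : ℕ → Type := fun m =>
    {p : (Site 4 (m + 1) × Site 4 (m + 1)) × ((Fin 4 × Fin 4) × (Fin 4 × Fin 4)) //
      p.1.1 ≠ p.1.2 ∧ p.2.1.1 ≠ p.2.1.2 ∧ p.2.2.1 ≠ p.2.2.2}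
  let X : ℕ → ℝ → ℕ → ℝ := fun m β n => (n : ℝ) ^ 8 * axisCov r (m + 1) β n
  let Y : (m : ℕ) → ℝ → ι m → ℝ := fun m β p =>
    |wcov r β (plaqField r p.1.1.1 p.1.2.1.1 p.1.2.1.2) (plaqField r p.1.1.2 p.1.2.2.1 p.1.2.2.2)| *
      torusDist p.1.1.1 p.1.1.2 ^ 8
  let D : (m : ℕ) → ι m → ℝ := fun m p => torusDist p.1.1.1 p.1.1.2
  have hT1 : ∀ m : ℕ, ∃ B : ℝ, ∀ β : ℝ, B ≤ β →
      (∀ n : ℕ, 1 ≤ n → 8 * n ≤ m + 1 → c₀ ≤ β ^ 2 * X m β n ∧ β ^ 2 * X m β n ≤ C₀) ∧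
        ∀ i : ι m, β ^ 2 * Y m β i ≤ C₀ := by
    intro m
    obtain ⟨B, hB⟩ := hT (m + 1)
    refine ⟨B, fun β hβ => ?_⟩
    obtain ⟨hax, hpr⟩ := hB β hβ
    exact ⟨fun n hn hnL => hax n hn hnL, fun p => hpr _ _ _ _ _ _ p.2.1 p.2.2.1 p.2.2.2⟩
  choose B hB using hT1
  have hYnn : ∀ m β (i : ι m), 0 ≤ Y m β i := fun m β i => by positivity
  have hD : ∀ m (i : ι m), ∃ q : ℕ, 1 ≤ q ∧ D m i = Real.sqrt q := fun m i => torusDist_eq_sqrt i.2.1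
  obtain ⟨a, Γ, β₀, hpos, hlim, hΓ, hbox, hslow⟩ :=
    exists_slow_ruler_antitone X Y D hYnn hD hc₀ hB ω hω hanti
  refine ⟨a, Γ, β₀, c₀ / 4, C₀, by positivity, hpos, hlim, fun s _ _ => hΓ s, fun L _ β hβ hL => ?_, hslow⟩
  obtain ⟨m, rfl⟩ : ∃ m, L = m + 1 := ⟨L - 1, (Nat.succ_pred_eq_of_ne_zero (NeZero.ne L)).symm⟩
  have hL' : ((m : ℝ) + 1) * a β ≤ 1 := by push_cast at hL; exact hL
  obtain ⟨hax, hpr⟩ := hbox m β hβ hL'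
  exact ⟨fun n hn hnL => hax n hn hnL,
    fun x y i j i' j' hxy hij hij' => hpr ⟨((x, y), ((i, j), (i', j'))), hxy, hij, hij'⟩⟩

end Parts

/-- The fundamental lattice representation of `SU(N)` (faithful, continuous, unitary — tree facts). [folklore] -/
def suFund (N : ℕ) : LatticeRep (Matrix.specialUnitaryGroup (Fin N) ℂ) :=
  ⟨N, fundamentalRep (Fin N), continuous_fundamentalRep _, fundamentalRep_injective _,
    fundamentalRep_mem_unitaryGroup⟩

/-- **H — the standard scaling picture of some `SU(N)₄` lattice gauge theory (`N ≥ 2`), Borel σ-algebra as in the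
crux.** The conjunction of the ultraviolet statement `FixedTorusTwoSided` (fixed-torus `β → ∞` two-sided plaquette
covariances `≍ β⁻² dist⁻⁸`, side-uniform constants: femto-universe / lattice perturbation theory, Lüscher 1983,
Coste et al. 1985) and the WEAK infrared statement `XiUnbounded` (the correlation length in lattice units is
unbounded as `β → ∞` — along some sequence of couplings; implied by `ξ(β) → ∞`, Chatterjee, arXiv:1803.01950,
Problem 5.1). Both halves are universally believed and both are OPEN as theorems; neither mentions unit maps, shape
functions or the route. This is the hypothesis `H` of the negative lemma
`latticeGapInUVUnits_false_of_standardScalingSU : H → ¬ LatticeGapInUVUnits`. [cite: arXiv180301950, Problem 5.1] [cite: Luscher1983] [cite: CosteEtAl1985] -/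
@[conjecture] def StandardScalingSU : Prop :=
  ∃ N : ℕ, 2 ≤ N ∧
    letI : MeasurableSpace (Matrix.specialUnitaryGroup (Fin N) ℂ) := borel _
    haveI : BorelSpace (Matrix.specialUnitaryGroup (Fin N) ℂ) := ⟨rfl⟩
    FixedTorusTwoSided (suFund N) ∧ XiUnbounded (suFund N)

/-- **Negative lemma modulo `H = StandardScalingSU`: the crux `LatticeGapInUVUnits` AS TYPED is false in the
standard scaling picture.** `SU(N)`, `N ≥ 2`, is a compact simple Lie group UNCONDITIONALLY in the tree
(`isSimpleCompactGroup_specialUnitaryGroup_holds`), so the only inputs are the two halves of `H`. From `XiUnbounded`: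
couplings `βs j ≥ j + 1` at which a fixed pair `(A, B)` clusters more slowly than `e^{−n/(j+1)²}` on large tori, and
the antitone floor `ω = 1/(J(β)+1)` with `ω(βs j) ≥ 1/(j+1)`; from `FixedTorusTwoSided` via `exists_slow_package`: an
admissible ruler `a ≥ ω` on `[1, ∞)`; the crux gives a rate `c₁ > 0` for `a`, and at `βs j` with `1/(j+1) < c₁` its
bound `C₁ e^{−c₁ a(βs j) n} ≤ C₁ e^{−n/(j+1)²}`... is beaten by the slow clustering: contradiction. Classification if
`H` is ever discharged: `refuted-misstated` — the witness is a slowly and generically decaying STEP unit map; the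
repaired statement C′ restricts the crux to continuous unit maps (or adds `MonotoneOn Γ (Set.Ioc 0 ℓ₀)` to the
femto package), which the witness misses. CONTRAPOSITIVE (for planners): a proof of the crux AS TYPED would refute the
standard scaling picture of every `SU(N)` — any line on item 9366 not using a regularity of the unit map excluded by
the slow step rulers is attacking `StandardScalingSU`. [folklore] -/
theorem latticeGapInUVUnits_false_of_standardScalingSU : StandardScalingSU → ¬ LatticeGapInUVUnits := by
  rintro ⟨N, hN, hW⟩ hcrux
  letI : MeasurableSpace (Matrix.specialUnitaryGroup (Fin N) ℂ) := borel _
  haveI : BorelSpace (Matrix.specialUnitaryGroup (Fin N) ℂ) := ⟨rfl⟩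
  obtain ⟨hT, hXi⟩ := hW
  have hG : IsCompactSimpleLieGroup (Matrix.specialUnitaryGroup (Fin N) ℂ) :=
    isCompactSimpleLieGroup_specialUnitaryGroup isSimpleCompactGroup_specialUnitaryGroup_holds hN
  obtain ⟨A, B, hAB⟩ := hXi
  -- choice: beyond `b`, a coupling at which the pair `(A, B)` clusters more slowly than rate `ε`
  choose f hfb hf using hAB
  -- the couplings `βs j ≥ j + 1` with rate `< ε_j = 1/(j+1)²`, increasing
  let ε : ℕ → ℝ := fun j => 1 / ((j : ℝ) + 1) ^ 2
  have hε : ∀ j, 0 < ε j := fun j => by positivity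
  let βs : ℕ → ℝ := fun j => Nat.rec (f (ε 0) (hε 0) 1) (fun j b => f (ε (j + 1)) (hε (j + 1)) (b + 1)) j
  have hβs0 : βs 0 = f (ε 0) (hε 0) 1 := rfl
  have hβsS : ∀ j, βs (j + 1) = f (ε (j + 1)) (hε (j + 1)) (βs j + 1) := fun j => rfl
  have hβs_ge : ∀ j : ℕ, ((j : ℕ) : ℝ) + 1 ≤ βs j := by
    intro j
    induction j with
    | zero => simpa [hβs0] using hfb (ε 0) (hε 0) 1
    | succ j ih =>
      rw [hβsS]
      have := hfb (ε (j + 1)) (hε (j + 1)) (βs j + 1)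
      push_cast
      linarith
  have hβs_step : ∀ j, βs j + 1 ≤ βs (j + 1) := fun j => by
    rw [hβsS]; exact hfb _ _ _
  have hβs_mono : Monotone βs :=
    monotone_nat_of_le_succ fun j => by linarith [hβs_step j]
  have hβs_clause : ∀ j (S₀ : ℕ) (C : ℝ), ∃ S : ℕ, S₀ ≤ S ∧ ∃ n : ℕ, n ≤ S ∧
      C * Real.exp (-(ε j * n)) < |latticeConnectedCorr (suFund N).ρ (βs j) (2 * S + 1) A.F B.F n| := by
    intro j
    cases j with
    | zero => rw [hβs0]; exact hf (ε 0) (hε 0) 1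
    | succ j => rw [hβsS]; exact hf (ε (j + 1)) (hε (j + 1)) (βs j + 1)
  -- the antitone floor `ω = 1/(J(β) + 1)`, `J(β)` = the first index with `β ≤ βs j`
  have hex : ∀ β : ℝ, ({j : ℕ | β ≤ βs j} : Set ℕ).Nonempty := fun β =>
    ⟨⌈β⌉₊, (Nat.le_ceil β).trans (by linarith [hβs_ge ⌈β⌉₊])⟩
  let J : ℝ → ℕ := fun β => sInf {j : ℕ | β ≤ βs j}
  have hJspec : ∀ β, β ≤ βs (J β) := fun β => Nat.sInf_mem (hex β)
  have hJmono : ∀ {β β' : ℝ}, β ≤ β' → J β ≤ J β' := fun {β β'} hle =>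
    Nat.sInf_le (show J β' ∈ {j : ℕ | β ≤ βs j} from hle.trans (hJspec β'))
  have hJat : ∀ j : ℕ, J (βs j) ≤ j := fun j =>
    Nat.sInf_le (show j ∈ {i : ℕ | βs j ≤ βs i} from Set.mem_setOf.2 le_rfl)
  let ω : ℝ → ℝ := fun β => 1 / ((J β : ℝ) + 1)
  have hω_anti : Antitone ω := by
    intro β β' hle
    have h1 : (0 : ℝ) < (J β : ℝ) + 1 := by positivity
    exact one_div_le_one_div_of_le h1 (by exact_mod_cast Nat.succ_le_succ (hJmono hle))
  have hω_tendsto : Tendsto ω atTop (𝓝 0) := by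
    refine Metric.tendsto_atTop.2 fun δ hδ => ?_
    obtain ⟨K, hK⟩ := exists_nat_one_div_lt hδ
    refine ⟨βs K + 1, fun β hβ => ?_⟩
    have hKlt : K < J β := by
      by_contra hcon
      push Not at hcon
      have h1 : β ≤ βs (J β) := hJspec β
      have h2 := hβs_mono hcon
      linarith
    rw [Real.dist_eq, sub_zero, abs_of_pos (by positivity)]
    calc ω β = 1 / ((J β : ℝ) + 1) := rfl
      _ ≤ 1 / ((K : ℝ) + 1) :=
          one_div_le_one_div_of_le (by positivity) (by exact_mod_cast Nat.succ_le_succ hKlt.le)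
      _ < δ := hK
  have hω_at : ∀ j : ℕ, 1 / (((j : ℕ) : ℝ) + 1) ≤ ω (βs j) := fun j =>
    one_div_le_one_div_of_le (by positivity) (by exact_mod_cast Nat.succ_le_succ (hJat j))
  -- the slow admissible ruler above `ω`, and the crux applied to it (femto package with `ℓ₀ = 1`)
  obtain ⟨a, Γ, β₀, c, C, hc, hpos, hlim, hΓ, hbox, hslow⟩ :=
    exists_slow_package (suFund N) hT ω hω_tendsto hω_anti
  have hC := hcrux (Matrix.specialUnitaryGroup (Fin N) ℂ) hG (suFund N) a
    ⟨Γ, β₀, 1, c, C, one_pos, hc, hpos, hlim, hΓ, fun L _ β h₁ h₂ => hbox L β h₁ h₂⟩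
  obtain ⟨c₁, β₂, S₁, hc₁, hABc⟩ := hC
  obtain ⟨C₁, hC₁⟩ := hABc A B
  -- an index `j` with `βs j ≥ β₂` and `1/(j+1) < c₁`
  obtain ⟨j, hj⟩ : ∃ j : ℕ, max β₂ (1 / c₁) < (j : ℝ) + 1 :=
    ⟨⌈max β₂ (1 / c₁)⌉₊, (Nat.le_ceil _).trans_lt (lt_add_one _)⟩
  have hβ₂ : β₂ ≤ βs j := ((le_max_left _ _).trans hj.le).trans (hβs_ge j)
  have h1β : (1 : ℝ) ≤ βs j := le_trans (by linarith [(Nat.cast_nonneg j : (0 : ℝ) ≤ j)]) (hβs_ge j)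
  have hjc : 1 / ((j : ℝ) + 1) < c₁ := by
    have h1 : 1 / c₁ < (j : ℝ) + 1 := (le_max_right _ _).trans_lt hj
    rw [div_lt_iff₀ hc₁] at h1
    rw [div_lt_iff₀ (by positivity)]
    linarith
  obtain ⟨S, hS, n, hn, hlt⟩ := hβs_clause j (S₁ (βs j)) (max C₁ 1)
  have hup := hC₁ _ hβ₂ S n hS hn
  have hpos1 : (0 : ℝ) < max C₁ 1 := lt_max_of_lt_right one_pos
  have hchain : max C₁ 1 * Real.exp (-(ε j * n)) < max C₁ 1 * Real.exp (-(c₁ * a (βs j) * n)) :=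
    hlt.trans_le (hup.trans (mul_le_mul_of_nonneg_right (le_max_left _ _) (Real.exp_pos _).le))
  have hexp : Real.exp (-(ε j * n)) < Real.exp (-(c₁ * a (βs j) * n)) :=
    lt_of_mul_lt_mul_left hchain hpos1.le
  rw [Real.exp_lt_exp] at hexp
  have hn0 : (0 : ℝ) ≤ n := Nat.cast_nonneg n
  -- but `ε j = (1/(j+1))² < c₁ · (1/(j+1)) ≤ c₁ ω(βs j) ≤ c₁ a(βs j)`
  have hεle : ε j ≤ c₁ * a (βs j) := by
    have hω1 : 1 / ((j : ℝ) + 1) ≤ a (βs j) := (hω_at j).trans (hslow _ h1β)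
    have hq : (0 : ℝ) < 1 / ((j : ℝ) + 1) := by positivity
    calc ε j = 1 / ((j : ℝ) + 1) * (1 / ((j : ℝ) + 1)) := by
          show 1 / ((j : ℝ) + 1) ^ 2 = _
          rw [sq, one_div_mul_one_div]
      _ ≤ c₁ * a (βs j) := mul_le_mul hjc.le hω1 hq.le hc₁.le
  have : ε j * n ≤ c₁ * a (βs j) * n := mul_le_mul_of_nonneg_right hεle hn0
  linarith

end

end Summit.QuantumFields.YangMills.Theorems.LatticeGapInUVUnits.Negative
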